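import Summits.RiemannHypothesis.RiemannHypothesis.Theorems.GapsEvoDoorsFLData
import Summits.RiemannHypothesis.RiemannHypothesis.Theorems.GapsEvoDoorsPWProfile
import Summits.RiemannHypothesis.RiemannHypothesis.Theses.GapsEvoDoors

/-!
# GapsEvoDoors — the floor record-cell witness for `DeltaCIFloorNineTenths`: assembly

Cell rh-gaps (D-0143/D-0145), route `GapsEvoDoors`, item stmt-RiemannHypothesis-23031
`DeltaCIFloorNineTenths` (closed; this is a `--supports` record and does NOT restate the route
decl). The test function is engine EVO-TF-2's certified two-square PW-SOS object at the floor-axis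
WITNESS CELL OF RECORD `(Δ, f, λ) = (2, 17/20, 12/25)` (data and kernel arithmetic:
`GapsEvoDoorsFLData`):

  `r = r̃/N`, `r̃ = (P̂)ˇ`, `P̂(α) = λ²Q(|α|) + Q″(|α|)/(4π²)` on `[−K, K]` (`K = 3`), `0` beyond,

where `Q = Σ Wᵢ (H̃ᵢ ⋆ H̃ᵢ)|_{[0,K]}` is the explicit degree-29 autocorrelation polynomial. Proved
here from the generic parts `GapsEvoDoorsPW{Poly,Fourier,Profile}`:
* `r̃(u) = (λ² − u²)·(W₁ĥ₁(u)² + W₂ĥ₂(u)²)` — so `r ≤ 0` off `[−λ, λ]` structurally;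
* `r` is even, continuous, `L¹`; `r̂ = P̂/N` (Fourier inversion), `r̂ ∈ L¹`;
* `P̂ ≥ 0` everywhere (kernel chain certificates at both brackets of `1/π²`), hence `r ≤ r(0) = 1`,
  `r̂ ≥ 0` on the floor range `1 ≤ |α| ≤ 2` and beyond;
* the floor certificate `c_fl(r; 2, 17/20) = r̂(0) − 1 + 2∫₀¹αr̂ + 2·(17/20)∫₁²r̂ = (a₀ + b₀/π²)/N − 1
  > 0` (`certificate_eq`, `certificate_pos`; value `∈ [0.00247827, 0.00247835]`; engine
  `≥ 0.0024749`, two-engine AGREE cell, referee V-17/V-20).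
`DeltaCIFloor_recordCell` states the cell `(2, 17/20, 12/25)` explicitly; the closing `example`
re-assembles the route's ∃. Reading: «f*(2) ≤ 17/20» (a floor fragment F ≥ 0.85 + ε on
1 < |α| ≤ 2 suffices for the door-(a) chain) is now a kernel theorem about an explicit `r` — a
record INSIDE the route; toward RiemannHypothesis: 0. computed ≠ proved for every other cell
number; nothing here bears on the truth of RH.
-/

noncomputable section

open MeasureTheory Set Real Filter Topology
open Literature.NumberTheory.LFunctions Literature.NumberTheory.LFunctions.BGMM2023

set_option linter.dupNamespace false  -- the mandated namespace repeats `RiemannHypothesis`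

namespace Summit.RiemannHypothesis.RiemannHypothesis.Theorems.GapsEvoDoorsFL

open GapsEvoDoorsPW GapsEvoDoorsPW.Poly

/-! ## Constants -/

/-- `1/π² ∈ [tlo, thi]` (from `3.141592 < π < 3.141593`). -/
theorem inv_pi_sq_mem_Icc : 1 / π ^ 2 ∈ Set.Icc (((tlo : ℚ) : ℝ)) ((thi : ℚ) : ℝ) := by
  have h1 : (3141592 : ℝ) / 1000000 < π := by
    have := Real.pi_gt_d6; norm_num at this ⊢; linarith
  have h2 : π < (3141593 : ℝ) / 1000000 := by
    have := Real.pi_lt_d6; norm_num at this ⊢; linarith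
  have hπ := Real.pi_pos
  rw [Set.mem_Icc]
  unfold tlo thi
  push_cast
  constructor
  · apply one_div_le_one_div_of_le (by positivity)
    nlinarith
  · apply one_div_le_one_div_of_le (by positivity)
    nlinarith

/-! ## The witness -/

/-- `r̃ = (P̂)ˇ`, the cosine transform of the frequency-side profile `P̂ = phat Q K λ`. -/
def rtilde : ℝ → ℝ := cosTransform (phat Q K (lam : ℚ))

/-- **The witness** `r = r̃ / N`. -/
def witness (u : ℝ) : ℝ := rtilde u / N

/-- `G := Σ Wᵢ (Hᵢ ⋆ Hᵢ)` is the even extension of `Q`: `qext Q K = W₁·auto p1 a + W₂·auto p2 a`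
(as functions). -/
theorem qext_eq_fun : qext Q K = fun α ↦ (W₁ : ℝ) * auto p1 a α + (W₂ : ℝ) * auto p2 a α := by
  funext α
  unfold qext auto evenExt
  rw [show ((K : ℚ) : ℝ) = 2 * ((a : ℚ) : ℝ) by unfold K a; norm_num]
  split_ifs with h
  · rw [← Qdef_eq]
    unfold Qdef
    simp only [eval_add, eval_smul]
  · simp

/-- **`r̃(u) = (λ² − u²)·(W₁ĥ₁(u)² + W₂ĥ₂(u)²)`** — the engine's structure, via
`(P̂)ˇ = (λ² − u²)·Ĝ` (parts) and `(Hᵢ ⋆ Hᵢ)^ = ĥᵢ²` (convolution theorem). -/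
theorem rtilde_eq (u : ℝ) :
    rtilde u = (((lam : ℚ) : ℝ) ^ 2 - u ^ 2) *
      ((W₁ : ℝ) * cosTransform (bump p1 a) u ^ 2 + (W₂ : ℝ) * cosTransform (bump p2 a) u ^ 2) := by
  have ha : (0 : ℚ) ≤ a := by unfold a; norm_num
  have hG : cosTransform (qext Q K) u =
      (W₁ : ℝ) * cosTransform (bump p1 a) u ^ 2 + (W₂ : ℝ) * cosTransform (bump p2 a) u ^ 2 := by
    rw [← cosTransform_auto p1 ha u, ← cosTransform_auto p2 ha u, qext_eq_fun]
    unfold cosTransform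
    rw [← integral_const_mul, ← integral_const_mul, ← integral_add]
    · refine integral_congr_ae (Eventually.of_forall fun ξ ↦ ?_)
      simp only
      ring
    · exact (integrable_mul_cos (integrable_auto p1 a) u).const_mul _
    · exact (integrable_mul_cos (integrable_auto p2 a) u).const_mul _
  rw [← hG]
  exact cosTransform_phat Q (by unfold K; norm_num) _ evalQ_Q_K evalQ_dQ_K evalQ_dQ_zero u

/-- `r̃` is even. -/
theorem rtilde_neg (u : ℝ) : rtilde (-u) = rtilde u := cosTransform_neg _ _

/-- `r̃` is continuous. -/
theorem continuous_rtilde : Continuous rtilde :=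
  continuous_cosTransform (phat_neg Q K _) (integrable_phat Q K _)

/-- `r̃ ∈ L¹`. -/
theorem integrable_rtilde : Integrable rtilde :=
  integrable_cosTransform_phat Q (by unfold K; norm_num) _ evalQ_Q_K evalQ_ddQ_K

/-- `(r̃)^ = P̂` (Fourier inversion). -/
theorem cosTransform_rtilde (α : ℝ) : cosTransform rtilde α = phat Q K (lam : ℚ) α :=
  cosTransform_cosTransform_phat Q (by unfold K; norm_num) _ evalQ_Q_K evalQ_ddQ_K α

/-- `r̃(0) = N`. -/
theorem rtilde_zero : rtilde 0 = (N : ℝ) := by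
  unfold rtilde
  rw [cosTransform_phat_zero Q (show (0 : ℚ) ≤ K by unfold K; norm_num) _ evalQ_dQ_K evalQ_dQ_zero]
  unfold N
  push_cast
  ring

/-- `(r̃)^ = P̂ ≥ 0` everywhere: on `[0, K]`, `λ²Q + Q″/(4π²) = (K − x)·(RA + RB/π²)` with the
quotient certified nonnegative at both rational brackets of `1/π²`. -/
theorem cosTransform_rtilde_nonneg (α : ℝ) : 0 ≤ cosTransform rtilde α := by
  rw [cosTransform_rtilde]
  unfold phat
  refine evenExt_nonneg (fun x h0 hK ↦ ?_) α
  have hA : ((lam : ℚ) : ℝ) ^ 2 * eval Q x = ((K : ℚ) - x) * eval RA x := by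
    have h := congrArg (fun P ↦ eval P x) RA_eq
    simp only [eval_mul, eval_smul, eval_cons, eval_nil] at h
    push_cast at h
    linear_combination -h
  have hB : eval (deriv (deriv Q)) x / 4 = ((K : ℚ) - x) * eval RB x := by
    have h := congrArg (fun P ↦ eval P x) RB_eq
    simp only [eval_mul, eval_smul, eval_cons, eval_nil] at h
    push_cast at h
    linear_combination -h
  have ht := inv_pi_sq_mem_Icc
  rw [Set.mem_Icc] at ht
  have hlo := nonneg_of_chainFrom (add RA (smul tlo RB)) chainLo 0 chainLo_ok x
    (by exact_mod_cast h0) (by rw [chainLo_last]; exact hK)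
  have hhi := nonneg_of_chainFrom (add RA (smul thi RB)) chainHi 0 chainHi_ok x
    (by exact_mod_cast h0) (by rw [chainHi_last]; exact hK)
  simp only [eval_add, eval_smul] at hlo hhi
  have hπ : π ≠ 0 := Real.pi_ne_zero
  have e : ((lam : ℚ) : ℝ) ^ 2 * eval Q x + eval (deriv (deriv Q)) x / (4 * π ^ 2) =
      (((K : ℚ) : ℝ) - x) * (eval RA x + 1 / π ^ 2 * eval RB x) := by
    have e2 : eval (deriv (deriv Q)) x / (4 * π ^ 2) =
        eval (deriv (deriv Q)) x / 4 * (1 / π ^ 2) := by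
      field_simp
    rw [hA, e2, hB]
    ring
  rw [e]
  refine mul_nonneg (by linarith) ?_
  rcases le_or_gt 0 (eval RB x) with hR | hR
  · nlinarith [ht.1]
  · nlinarith [ht.2]

/-! ## The clauses of `DeltaCIFinite` -/

/-- `r` is even. -/
theorem witness_neg (u : ℝ) : witness (-u) = witness u := by
  unfold witness; rw [rtilde_neg]

/-- `r` is continuous. -/
theorem continuous_witness : Continuous witness := continuous_rtilde.div_const _

/-- `r ∈ L¹`. -/
theorem integrable_witness : Integrable witness := integrable_rtilde.div_const _

/-- **`r̂ = P̂/N`**. -/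
theorem cosTransform_witness (α : ℝ) :
    cosTransform witness α = phat Q K ((lam : ℚ) : ℝ) α / N := by
  rw [← cosTransform_rtilde α]
  unfold cosTransform witness
  rw [← integral_div]
  refine integral_congr_ae (Eventually.of_forall fun u ↦ ?_)
  simp only
  ring

/-- `r̂ ∈ L¹`. -/
theorem integrable_cosTransform_witness : Integrable (cosTransform witness) := by
  have h : cosTransform witness = fun α ↦ phat Q K ((lam : ℚ) : ℝ) α / N :=
    funext cosTransform_witness
  rw [h]
  exact (integrable_phat Q K _).div_const _

/-- `r̂ ≥ 0` everywhere (in particular for `|α| ≥ Δ`). -/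
theorem cosTransform_witness_nonneg (α : ℝ) : 0 ≤ cosTransform witness α := by
  have hN : (0 : ℝ) < N := by exact_mod_cast N_pos
  have h := cosTransform_rtilde_nonneg α
  rw [cosTransform_rtilde] at h
  rw [cosTransform_witness]
  exact div_nonneg h hN.le

/-- `r(0) = 1`. -/
theorem witness_zero : witness 0 = 1 := by
  have hN : (0 : ℝ) < N := by exact_mod_cast N_pos
  unfold witness
  rw [rtilde_zero, div_self hN.ne']

/-- `r ≤ 1` (`r ≤ r(0)` since `r̂ ≥ 0`). -/
theorem witness_le_one (u : ℝ) : witness u ≤ 1 := by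
  rw [← witness_zero]
  exact le_map_zero_of_cosTransform_nonneg continuous_witness integrable_witness witness_neg
    cosTransform_witness_nonneg u

/-- `r ≤ 0` off `[−λ, λ]`, `λ = 12/25` — structurally, from `r̃ = (λ² − u²)·Ĝ`, `Ĝ ≥ 0`. -/
theorem witness_nonpos {u : ℝ} (hu : (12 / 25 : ℝ) < |u|) : witness u ≤ 0 := by
  have hN : (0 : ℝ) < N := by exact_mod_cast N_pos
  unfold witness
  rw [div_le_iff₀ hN, zero_mul, rtilde_eq]
  have hl : ((lam : ℚ) : ℝ) = 12 / 25 := by unfold lam; norm_num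
  have hu2 : ((lam : ℚ) : ℝ) ^ 2 < u ^ 2 := by
    rw [hl, ← sq_abs u]
    exact pow_lt_pow_left₀ hu (by norm_num) two_ne_zero
  have h1 : (0 : ℝ) ≤ W₁ := by unfold W₁; norm_num
  have h2 : (0 : ℝ) ≤ W₂ := by unfold W₂; norm_num
  exact mul_nonpos_of_nonpos_of_nonneg (by linarith) (by positivity)

/-! ## The certificate -/

/-- On `[0, 2] ⊆ [0, K]` the profile is the polynomial expression. -/
theorem phat_of_mem {α : ℝ} (h0 : 0 ≤ α) (h1 : α ≤ 2) :
    phat Q K ((lam : ℚ) : ℝ) α =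
      ((lam : ℚ) : ℝ) ^ 2 * eval Q α + eval (deriv (deriv Q)) α / (4 * π ^ 2) := by
  unfold phat
  have hK : ((K : ℚ) : ℝ) = 3 := by unfold K; norm_num
  exact evenExt_of_nonneg_le h0 (by rw [hK]; linarith)

/-- **The floor certificate in closed form**: `c_fl(r; 2, 17/20) = (a₀ + b₀/π²)/N − 1`. -/
theorem certificate_eq :
    cosTransform witness 0 - 1 + 2 * (∫ α in (0 : ℝ)..1, α * cosTransform witness α) +
      2 * (17 / 20) * (∫ α in (1 : ℝ)..2, cosTransform witness α) =
      ((a₀ : ℝ) + (b₀ : ℝ) * (1 / π ^ 2)) / N - 1 := by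
  have hN : (0 : ℝ) < N := by exact_mod_cast N_pos
  have hπ : π ≠ 0 := Real.pi_ne_zero
  have hwin : ∫ α in (1 : ℝ)..2, cosTransform witness α =
      ∫ α in (1 : ℝ)..2, 1 / N *
        (((lam : ℚ) : ℝ) ^ 2 * eval Q α + eval (deriv (deriv Q)) α / (4 * π ^ 2)) := by
    refine intervalIntegral.integral_congr fun α hα ↦ ?_
    rw [uIcc_of_le (by norm_num)] at hα
    rw [cosTransform_witness, phat_of_mem (by linarith [hα.1]) hα.2]
    ring
  have hmom : ∫ α in (0 : ℝ)..1, α * cosTransform witness α =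
      ∫ α in (0 : ℝ)..1, 1 / N *
        (((lam : ℚ) : ℝ) ^ 2 * eval (mulX Q) α + eval (mulX (deriv (deriv Q))) α / (4 * π ^ 2)) := by
    refine intervalIntegral.integral_congr fun α hα ↦ ?_
    rw [uIcc_of_le zero_le_one] at hα
    rw [cosTransform_witness, phat_of_mem hα.1 (by linarith [hα.2]), eval_mulX, eval_mulX]
    ring
  have h0 : cosTransform witness 0 =
      (((lam : ℚ) : ℝ) ^ 2 * (evalQ Q 0 : ℝ) + (evalQ (deriv (deriv Q)) 0 : ℝ) / (4 * π ^ 2)) / N := by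
    rw [cosTransform_witness, phat_of_mem le_rfl (by norm_num)]
    have e1 := eval_ratCast Q 0
    have e2 := eval_ratCast (deriv (deriv Q)) 0
    push_cast at e1 e2
    rw [e1, e2]
  have iA := integral_eval_rat (mulX Q) 0 1
  have iB := integral_eval_rat (mulX (deriv (deriv Q))) 0 1
  have iC := integral_eval_rat Q 1 2
  have iD := integral_eval_rat (deriv (deriv Q)) 1 2
  push_cast at iA iB iC iD
  rw [hwin, hmom, h0, intervalIntegral.integral_const_mul, intervalIntegral.integral_const_mul,
    intervalIntegral.integral_add ((continuous_eval _).const_mul _ |>.intervalIntegrable _ _)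
      (((continuous_eval _).div_const _).intervalIntegrable _ _),
    intervalIntegral.integral_add ((continuous_eval _).const_mul _ |>.intervalIntegrable _ _)
      (((continuous_eval _).div_const _).intervalIntegrable _ _),
    intervalIntegral.integral_const_mul, intervalIntegral.integral_div,
    intervalIntegral.integral_const_mul, intervalIntegral.integral_div, iA, iB, iC, iD]
  unfold a₀ b₀ f Δ
  push_cast
  field_simp
  ring

/-- **The floor certificate is positive** (`N < a₀ + b₀t` at both rational brackets of `1/π²`). -/
theorem certificate_pos :
    0 < cosTransform witness 0 - 1 + 2 * (∫ α in (0 : ℝ)..1, α * cosTransform witness α) +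
      2 * (17 / 20) * (∫ α in (1 : ℝ)..2, cosTransform witness α) := by
  have hN : (0 : ℝ) < N := by exact_mod_cast N_pos
  rw [certificate_eq, sub_pos, one_lt_div hN]
  have hlo : ((N : ℚ) : ℝ) < a₀ + b₀ * tlo := by exact_mod_cast cert_lo
  have hhi : ((N : ℚ) : ℝ) < a₀ + b₀ * thi := by exact_mod_cast cert_hi
  have ht := inv_pi_sq_mem_Icc
  rw [Set.mem_Icc] at ht
  rcases le_or_gt 0 ((b₀ : ℚ) : ℝ) with hb | hb
  · nlinarith [ht.1]
  · nlinarith [ht.2]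

/-! ## Assembly -/

/-- **`DeltaCIFloorNineTenths` at the witness cell of record `(Δ, f, λ) = (2, 17/20, 12/25)`**: an
explicit even, continuous, integrable `r` with `r̂ ∈ L¹`, `r ≤ 1`, `r ≤ 0` off `[−12/25, 12/25]`,
`r̂ ≥ 0` everywhere (a fortiori on `1 ≤ |α| ≤ 2` and for `|α| ≥ 2`), and positive floor
certificate `c_fl(r; 2, 17/20) > 0` — the engine's FL object, kernel-checked. -/
theorem DeltaCIFloor_recordCell : ∃ r : ℝ → ℝ,
    (∀ u : ℝ, r (-u) = r u) ∧ Continuous r ∧ Integrable r ∧ Integrable (cosTransform r) ∧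
    (∀ u : ℝ, r u ≤ 1) ∧ (∀ u : ℝ, (12 / 25 : ℝ) < |u| → r u ≤ 0) ∧
    (∀ α : ℝ, 0 ≤ cosTransform r α) ∧
    0 < cosTransform r 0 - 1 + 2 * (∫ α in (0 : ℝ)..1, α * cosTransform r α) +
      2 * (17 / 20) * (∫ α in (1 : ℝ)..2, cosTransform r α) :=
  ⟨witness, witness_neg, continuous_witness, integrable_witness, integrable_cosTransform_witness,
    witness_le_one, fun _ hu ↦ witness_nonpos hu, cosTransform_witness_nonneg, certificate_pos⟩

/-- The clauses re-assemble to the route's ∃-statement (kernel check as an `example`: the item is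
already closed by `GapsEvoDoorsFloor.DeltaCIFloorNineTenths_holds`, so no second declaration of
the same statement is made): witness `(Δ, λ, f, r) = (2, 12/25, 17/20, r)`. -/
example : Summit.RiemannHypothesis.RiemannHypothesis.Theses.GapsEvoDoors.DeltaCIFloorNineTenths :=
  ⟨2, 12 / 25, 17 / 20, witness, by norm_num, by norm_num, by norm_num, by norm_num, by norm_num,
    witness_neg, continuous_witness, integrable_witness, integrable_cosTransform_witness,
    witness_le_one, fun _ hu ↦ witness_nonpos hu, fun α _ ↦ cosTransform_witness_nonneg α,
    fun α _ _ ↦ cosTransform_witness_nonneg α, certificate_pos⟩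

end Summit.RiemannHypothesis.RiemannHypothesis.Theorems.GapsEvoDoorsFL

end
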